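import Summits.NavierStokesRegularity.NavierStokesRegularity.Theses.CorkscrewDynamo
import Summits.NavierStokesRegularity.NavierStokesRegularity.Theorems.CorkscrewDynamoNoSmallConstantWindDynamoEnergy
import HarnessLib

/-!
# `NoSmallConstantWindDynamo`: the small-constant kinematic anti-dynamo theorem in Leray's wind
# (route `CorkscrewDynamo`, item stmt-NavierStokesRegularity-11288) — PROVED

Main file. Statement (route decl
`Summit.NavierStokesRegularity.NavierStokesRegularity.Theses.CorkscrewDynamo.NoSmallConstantWindDynamo`):
if `B : ℝ³ → ℝ³` is smooth, steady and divergence free with `|y| |B(y)| ≤ a`, `‖DB(y)‖ ≤ b` and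
`b + a/4 < 1`, then every jointly smooth, divergence-free eternal solution `Ω` of the induction
equation `∂ₛΩ = curl((B + ½y) × Ω) + ΔΩ` on `ℝ × ℝ³` with `(1 + |y|)² |Ω(s, y)| ≤ K e^{μs}`
(`μ ≥ 0`, all `s`) is `≡ 0`.

Proof (Gaussian energy method with a spatial cut-off, so that no parabolic estimates for `∇Ω`
are needed): with `γ = e^{−|y|²/4}`, `κ = 1 − b − a/4 > 0` and `G_R(s) = ∫ γ χ_R² |Ω(s)|²`, the
sibling files give `e^{2κs₁} G_R(s₁) ≤ e^{2κs₀}(K e^{μs₀})² M + O(1/R)(s₁ − s₀)`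
(`gaussian_cutoff_energy_gronwall`); dominated convergence (`χ_R → 1`) and `s₀ → −∞` give
`∫ γ |Ω(s₁)|² ≤ 0`, whence `Ω(s₁, ·) ≡ 0` (`wind_induction_liouville`); `norm_wind_le` supplies the
bound `|B| ≤ |B(0)| + b + a` used for the cut-off error, and `noSmallConstantWindDynamo_proof`
unfolds the route decl (`timeDerivWithin univ = deriv`).

References: the `L²(γ)` identity is the whole-space, Leray-drift version of the Backus/Childress
necessary conditions for dynamo action (Backus 1958; Davidson 2001, §5); folklore.
-/

noncomputable section

open MeasureTheory Set Function Filter Topology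
open scoped Laplacian InnerProductSpace RealInnerProductSpace ContDiff

namespace Summit.NavierStokesRegularity.NavierStokesRegularity.Theorems

-- the summit and its single sub-problem share the name (CONVENTIONS §1), as in every Theorems file
set_option linter.dupNamespace false

open Literature.Analysis Literature.Analysis.FluidPDE

section Main

variable {a b μ K : ℝ} {B : EuclideanSpace ℝ (Fin 3) → EuclideanSpace ℝ (Fin 3)} {Ω : ℝ → EuclideanSpace ℝ (Fin 3) → EuclideanSpace ℝ (Fin 3)}

/-- **A steady wind in the Type-I envelope is bounded**: `|y||B(y)| ≤ a` and `‖DB‖ ≤ b` give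
`|B(y)| ≤ |B(0)| + b + a` (mean value theorem on the unit ball, the envelope outside). [folklore] -/
theorem norm_wind_le (hB : ContDiff ℝ 1 B) (ha : ∀ y, ‖y‖ * ‖B y‖ ≤ a)
    (hb : ∀ y, ‖fderiv ℝ B y‖ ≤ b) (y : EuclideanSpace ℝ (Fin 3)) : ‖B y‖ ≤ ‖B 0‖ + b + a := by
  have ha0 : 0 ≤ a := le_trans (by positivity) (ha y)
  have hb0 : 0 ≤ b := (norm_nonneg _).trans (hb 0)
  by_cases hy : 1 ≤ ‖y‖
  · have h1 : ‖B y‖ ≤ a :=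
      calc ‖B y‖ = 1 * ‖B y‖ := (one_mul _).symm
        _ ≤ ‖y‖ * ‖B y‖ := mul_le_mul_of_nonneg_right hy (norm_nonneg _)
        _ ≤ a := ha y
    linarith [norm_nonneg (B 0)]
  · push Not at hy
    have hmv : ‖B y - B 0‖ ≤ b * ‖y - 0‖ :=
      (convex_univ).norm_image_sub_le_of_norm_fderiv_le (𝕜 := ℝ)
        (fun x _ => hB.differentiable one_ne_zero x) (fun x _ => hb x) (mem_univ 0) (mem_univ y)
    rw [sub_zero] at hmv
    have h2 : ‖B y‖ ≤ ‖B 0‖ + ‖B y - B 0‖ := norm_le_insert' _ _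
    nlinarith [norm_nonneg y]

/-- **The small-constant kinematic anti-dynamo theorem in Leray's wind (pointwise form).** Let
`B ∈ C¹` be a steady divergence-free wind with `|y||B(y)| ≤ a`, `‖DB(y)‖ ≤ b`, `b + a/4 < 1`, and
let `Ω` be a jointly smooth, divergence-free ETERNAL solution of the induction equation
`∂ₛΩ = curl((B + ½y) × Ω) + ΔΩ` on `ℝ × ℝ³` in the class `(1 + |y|)² |Ω(s, y)| ≤ K e^{μs}`, `μ ≥ 0`.
Then `Ω ≡ 0`. Proof: with `κ = 1 − b − a/4 > 0` and the cut-off Gaussian energies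
`G_R(s) = ∫ γ χ_R² |Ω(s)|²`, the Grönwall step `gaussian_cutoff_energy_gronwall` gives
`e^{2κs₁} G_R(s₁) ≤ e^{2κs₀}(K e^{μs₀})² M + O(1/R)(s₁ − s₀)`; let `R → ∞` (dominated convergence,
`χ_R → 1`) and then `s₀ → −∞` (`κ > 0`): `∫ γ |Ω(s₁)|² ≤ 0`, so the continuous nonnegative
integrand vanishes identically. This is the `L²(e^{−|y|²/4})` energy method behind the
Backus/Childress necessary conditions for dynamo action (Backus 1958; Davidson 2001, §5),
transplanted to the whole space with Leray's drift `½ y` (dilution `−1`, transport absorbed by the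
weight). [folklore] -/
theorem wind_induction_liouville (hB : ContDiff ℝ 1 B) (hdivB : VectorCalculus.IsDivFree B)
    (ha : ∀ y, ‖y‖ * ‖B y‖ ≤ a) (hb : ∀ y, ‖fderiv ℝ B y‖ ≤ b) (hab : b + a / 4 < 1) (hμ : 0 ≤ μ)
    (hΩ : IsSmoothSpaceTimeOn univ Ω) (hdivΩ : ∀ s, VectorCalculus.IsDivFree (Ω s))
    (hpde : ∀ s y, deriv (fun τ => Ω τ y) s =
      curl (fun z => cross (B z + (1 / 2 : ℝ) • z) (Ω s z)) y + (Δ (Ω s)) y)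
    (hK : ∀ s y, (1 + ‖y‖) ^ 2 * ‖Ω s y‖ ≤ K * Real.exp (μ * s)) (s₁ : ℝ) (y₀ : EuclideanSpace ℝ (Fin 3)) :
    Ω s₁ y₀ = 0 := by
  have hκ0 : 0 < 1 - b - a / 4 := by linarith
  have hβ : ∀ y, ‖B y‖ ≤ ‖B 0‖ + b + a := norm_wind_le hB ha hb
  obtain ⟨C, -, hC⟩ := exists_norm_fderiv_cutoff_le (E := EuclideanSpace ℝ (Fin 3))
  -- the Grönwall step, for every `R > 0` and `s₀ ≤ s₁`
  have hgr := fun (R : ℝ) (hR : 0 < R) (s₀ : ℝ) (hs : s₀ ≤ s₁) =>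
    gaussian_cutoff_energy_gronwall hB hdivB ha hb hab hβ hμ hΩ hdivΩ hpde hK hR (hC R hR) hs
  set κ := 1 - b - a / 4 with hκ
  set M := ∫ y : EuclideanSpace ℝ (Fin 3), (1 + ‖y‖) ^ (-(4 : ℝ)) with hM
  set β := ‖B 0‖ + b + a with hβdef
  set γ : EuclideanSpace ℝ (Fin 3) → ℝ := fun y => Real.exp (-‖y‖ ^ 2 / 4) with hγdef
  have hγ0 : ∀ y, 0 ≤ γ y := fun y => (Real.exp_pos _).le
  have hγ1 : ∀ y, γ y ≤ 1 := fun y => Real.exp_le_one_iff.2 (by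
    have := sq_nonneg ‖y‖; linarith)
  have cγ : Continuous γ := (contDiff_gaussianWeightFun (n := 0)).continuous
  have cΩ : Continuous (Ω s₁) := (hΩ.contDiff_slice (mem_univ s₁)).continuous
  -- Step 1: `R → ∞` by dominated convergence (`χ_R → 1`, domination by the Type-I envelope)
  have hlim : Tendsto (fun R : ℝ => ∫ y, γ y * cutoff R y ^ 2 * ‖Ω s₁ y‖ ^ 2) atTop
      (𝓝 (∫ y, γ y * ‖Ω s₁ y‖ ^ 2)) := by
    refine tendsto_integral_filter_of_dominated_convergence
      (fun y => (K * Real.exp (μ * s₁)) ^ 2 * (1 + ‖y‖) ^ (-(4 : ℝ))) ?_ ?_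
      (integrable_one_add_norm_neg_four.const_mul _) ?_
    · exact Eventually.of_forall fun R =>
        ((cγ.mul ((contDiff_cutoff (n := 0) R).continuous.pow 2)).mul (cΩ.norm.pow 2)).aestronglyMeasurable
    · refine Eventually.of_forall fun R => Eventually.of_forall fun y => ?_
      rw [Real.norm_of_nonneg (mul_nonneg (mul_nonneg (hγ0 y) (sq_nonneg _)) (sq_nonneg _))]
      have h1 : γ y * cutoff R y ^ 2 ≤ 1 := by
        refine mul_le_one₀ (hγ1 y) (sq_nonneg _) ?_
        have := abs_cutoff_le_one R y
        rw [← sq_abs]; nlinarith [abs_nonneg (cutoff R y)]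
      calc γ y * cutoff R y ^ 2 * ‖Ω s₁ y‖ ^ 2 ≤ 1 * ‖Ω s₁ y‖ ^ 2 :=
            mul_le_mul_of_nonneg_right h1 (sq_nonneg _)
        _ ≤ (K * Real.exp (μ * s₁)) ^ 2 * (1 + ‖y‖) ^ (-(4 : ℝ)) := by
            rw [one_mul]; exact norm_sq_le_of_weighted_bound hK s₁ y
    · refine Eventually.of_forall fun y => tendsto_const_nhds.congr' ?_
      filter_upwards [eventually_cutoff_eq_one y] with R hR
      rw [hR, one_pow, mul_one]
  -- the cut-off error vanishes as `R → ∞`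
  have hε : Tendsto (fun R : ℝ => C / R * β + 3 * (C / R) ^ 2) atTop (𝓝 0) := by
    have h1 : Tendsto (fun R : ℝ => C / R) atTop (𝓝 0) := tendsto_id.const_div_atTop C
    have h2 := (h1.mul_const β).add ((h1.pow 2).const_mul 3)
    simpa using h2
  -- Step 2: for every `s₀ ≤ s₁`, `e^{2κs₁} ∫ γ|Ω(s₁)|² ≤ e^{2κs₀} (K e^{μs₀})² M`
  have step2 : ∀ s₀, s₀ ≤ s₁ → Real.exp (2 * κ * s₁) * ∫ y, γ y * ‖Ω s₁ y‖ ^ 2 ≤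
      Real.exp (2 * κ * s₀) * ((K * Real.exp (μ * s₀)) ^ 2 * M) := by
    intro s₀ hs
    have hL : Tendsto (fun R : ℝ => Real.exp (2 * κ * s₀) * ((K * Real.exp (μ * s₀)) ^ 2 * M)
        + Real.exp (2 * κ * s₁) * (2 * ((C / R * β + 3 * (C / R) ^ 2) *
            ((K * Real.exp (μ * s₁)) ^ 2 * M))) * (s₁ - s₀)) atTop
        (𝓝 (Real.exp (2 * κ * s₀) * ((K * Real.exp (μ * s₀)) ^ 2 * M))) := by
      have h := (((hε.mul_const ((K * Real.exp (μ * s₁)) ^ 2 * M)).const_mul 2).const_mul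
        (Real.exp (2 * κ * s₁))).mul_const (s₁ - s₀)
      have h' := h.const_add (Real.exp (2 * κ * s₀) * ((K * Real.exp (μ * s₀)) ^ 2 * M))
      simpa using h'
    have hev : ∀ᶠ R : ℝ in atTop, Real.exp (2 * κ * s₁) *
        (∫ y, γ y * cutoff R y ^ 2 * ‖Ω s₁ y‖ ^ 2) ≤
        Real.exp (2 * κ * s₀) * ((K * Real.exp (μ * s₀)) ^ 2 * M)
          + Real.exp (2 * κ * s₁) * (2 * ((C / R * β + 3 * (C / R) ^ 2) *
            ((K * Real.exp (μ * s₁)) ^ 2 * M))) * (s₁ - s₀) := by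
      filter_upwards [eventually_gt_atTop 0] with R hR using hgr R hR s₀ hs
    exact le_of_tendsto_of_tendsto (hlim.const_mul _) hL hev
  -- Step 3: `s₀ → −∞` (`κ > 0`): the Gaussian energy at `s₁` is `≤ 0`
  have hK0 : 0 ≤ K := by
    have h := hK 0 0
    rw [mul_zero, Real.exp_zero, mul_one] at h
    exact le_trans (by positivity) h
  have hM0 : 0 ≤ M := integral_nonneg fun y => Real.rpow_nonneg (by positivity) _
  have step3 : Real.exp (2 * κ * s₁) * ∫ y, γ y * ‖Ω s₁ y‖ ^ 2 ≤ 0 := by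
    have hT : Tendsto (fun s₀ : ℝ => Real.exp (2 * κ * s₀) * ((K * Real.exp (μ * s₁)) ^ 2 * M))
        atBot (𝓝 0) := by
      have h1 : Tendsto (fun s₀ : ℝ => 2 * κ * s₀) atBot atBot :=
        tendsto_id.const_mul_atBot (by positivity)
      have h2 := (Real.tendsto_exp_atBot.comp h1).mul_const ((K * Real.exp (μ * s₁)) ^ 2 * M)
      simpa using h2
    refine ge_of_tendsto hT ?_
    filter_upwards [eventually_le_atBot s₁] with s₀ hs
    refine (step2 s₀ hs).trans (mul_le_mul_of_nonneg_left ?_ (Real.exp_pos _).le)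
    exact mul_le_mul_of_nonneg_right (pow_le_pow_left₀ (by positivity)
      (mul_le_mul_of_nonneg_left (Real.exp_le_exp.2 (mul_le_mul_of_nonneg_left hs hμ)) hK0) 2) hM0
  -- Step 4: a continuous nonnegative integrable function with integral `≤ 0` vanishes
  have hint : Integrable (fun y => γ y * ‖Ω s₁ y‖ ^ 2) := by
    refine Integrable.mono' (integrable_one_add_norm_neg_four.const_mul ((K * Real.exp (μ * s₁)) ^ 2))
      ((cγ.mul (cΩ.norm.pow 2)).aestronglyMeasurable) (Eventually.of_forall fun y => ?_)
    rw [Real.norm_of_nonneg (mul_nonneg (hγ0 y) (sq_nonneg _))]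
    calc γ y * ‖Ω s₁ y‖ ^ 2 ≤ 1 * ‖Ω s₁ y‖ ^ 2 := mul_le_mul_of_nonneg_right (hγ1 y) (sq_nonneg _)
      _ ≤ (K * Real.exp (μ * s₁)) ^ 2 * (1 + ‖y‖) ^ (-(4 : ℝ)) := by
          rw [one_mul]; exact norm_sq_le_of_weighted_bound hK s₁ y
  have hnn : 0 ≤ fun y => γ y * ‖Ω s₁ y‖ ^ 2 := fun y => mul_nonneg (hγ0 y) (sq_nonneg _)
  have hI0 : ∫ y, γ y * ‖Ω s₁ y‖ ^ 2 = 0 := by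
    refine le_antisymm ?_ (integral_nonneg hnn)
    by_contra h
    push Not at h
    have := mul_pos (Real.exp_pos (2 * κ * s₁)) h
    linarith
  have hae := (integral_eq_zero_iff_of_nonneg hnn hint).1 hI0
  have heq := ((cγ.mul (cΩ.norm.pow 2)).ae_eq_iff_eq volume continuous_const).1 hae
  have hy : (fun y => γ y * ‖Ω s₁ y‖ ^ 2) y₀ = (0 : EuclideanSpace ℝ (Fin 3) → ℝ) y₀ := congr_fun heq y₀
  have hy' : γ y₀ * ‖Ω s₁ y₀‖ ^ 2 = 0 := hy
  rcases mul_eq_zero.1 hy' with h | h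
  · exact absurd h (Real.exp_pos _).ne'
  · exact norm_eq_zero.1 ((pow_eq_zero_iff two_ne_zero).1 h)

end Main


/-- **`NoSmallConstantWindDynamo` (item stmt-NavierStokesRegularity-11288 of route `CorkscrewDynamo`),
proved.** If `B` is smooth, steady and divergence free with `sup |y||B(y)| ≤ a`,
`sup ‖∇B‖ ≤ b`, `b + a/4 < 1`, then every smooth divergence-free eternal solution of
`∂ₛΩ = curl((B + ½y) × Ω) + ΔΩ` with `(1 + |y|)² |Ω(s, y)| ≤ K e^{μs}` (`μ ≥ 0`) vanishes
identically (`wind_induction_liouville`; `timeDerivWithin univ = deriv`). [folklore] -/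
theorem noSmallConstantWindDynamo_proof :
    Summit.NavierStokesRegularity.NavierStokesRegularity.Theses.CorkscrewDynamo.NoSmallConstantWindDynamo := by
  unfold Theses.CorkscrewDynamo.NoSmallConstantWindDynamo
  intro a b B hB hdivB ha hb hab Ω μ K hμ hΩ hdivΩ hpde hK
  have hpde' : ∀ s y, deriv (fun τ => Ω τ y) s =
      curl (fun z => cross (B z + (1 / 2 : ℝ) • z) (Ω s z)) y + (Δ (Ω s)) y := fun s y => by
    rw [← hpde s y, timeDerivWithin_apply, derivWithin_univ]
  funext s y
  exact wind_induction_liouville (hB.of_le (by exact_mod_cast le_top)) hdivB ha hb hab hμ hΩ hdivΩ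
    hpde' hK s y


end Summit.NavierStokesRegularity.NavierStokesRegularity.Theorems

end
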